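import Literature.NumberTheory.DiophantineGeometry.MultiplicativeGroupApproximation
import HarnessLib

/-!
# The approximation bound over `ℚ` in constant-existential SHAPE form, and its two halves

Topic `NumberTheory/DiophantineGeometry`; namespace `Literature.NumberTheory.DiophantineGeometry.Dioph`.

Pasten, *Invent. Math.* 236 (2024), Theorem 2.1 with `d = 1` (= Evertse–Győry, *Unit Equations in
Diophantine Number Theory*, Thm. 4.2.1 over `K = ℚ` at `α = 1`) is typed in the tree as the
`K`-parametric predicate `PastenApproximationBound K` (file `MultiplicativeGroupApproximation.lean`),
PROVED there for `K = pastenK = 480·(16e)^8` from the named fact `evertseGyory_thm_4_2_1_rat`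
(`pasten2024_thm_2_1`). Every Baker-class consumer over `ℚ` in the tree takes a hypothesis
`(hP : PastenApproximationBound K)` with `K` universally quantified (42 binders in 17 files, census
HOME/plan-m3/next/consumers-K-parametric.txt of cell `abc-stewartyu`). This file names the three
constant-existential statements those consumers are unconditional under:

* `approximationBound_rat`      — `∃ K ≥ 1, PastenApproximationBound K` (both places; "A1.L");
* `archApproximationBound_rat`  — the archimedean clause with `∃ K ≥ 1` ("A1.L(∞)");
* `padicApproximationBound_rat` — the `p`-adic clause with `∃ K ≥ 1` ("A1.L(p)"; same text, up to
  `1 ≤ K`, as the route item `Summit.ABC.ABC.Theses.GiantExponentRegime.PadicUnitBound`, which a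
  Literature file cannot import);

and PROVES the links: each of the three is implied by the existing named fact
`evertseGyory_thm_4_2_1_rat` (through `pasten2024_thm_2_1`), `approximationBound_rat` is the
conjunction of its halves (`K := max K∞ K_p`, monotonicity of `K ↦ K^m` on `1 ≤ K`), and the
projections. No new mathematics; statements requested by the cell's planner
(HOME/plan-m3/next/D1-ApproximationBoundRat.lean, AFTER-M3-GENERAL-ALPHA-BRIEF.md §2, WP-L.D) as the
registered `closes_target` of the general-`α` library rung and the names of its two sub-rungs.

## References

* [Pasten2024] H. Pasten, *The largest prime factor of `n² + 1` and improvements on subexponential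
  ABC*, Invent. Math. 236 (2024) 373–385, arXiv:2312.03566 — Theorem 2.1 (with `d = 1`).
* [EvertseGyory2015] J.-H. Evertse, K. Győry, *Unit Equations in Diophantine Number Theory*,
  CUP 2015 — Theorem 4.2.1 (p. 68), proof pp. 80–81 (case `K = ℚ`, `α = 1`).
-/

noncomputable section

open Finset Real Height

namespace Literature.NumberTheory.DiophantineGeometry.Dioph

/-! ### The three shape statements -/

/-- **The approximation bound over `ℚ` in shape form** ("A1.L"): Pasten 2024, Thm 2.1 for `d = 1`
(= Evertse–Győry Thm 4.2.1 over `ℚ` at `α = 1`) with the constant existential: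
`∃ K ≥ 1, PastenApproximationBound K` — for non-torsion `ξ₁,…,ξ_m ∈ ℚ*`, `x = ±∏ξᵢ^{bᵢ} ≠ 1`:
`−log|1 − x| < K^m log max{e, h(x)} ∏h(ξᵢ)` and, for every prime `p`,
`ord_p(1 − x) log p < K^m (p/log p) log max{e, p·h(x)} ∏h(ξᵢ)`. Every `…_of_approximationBound`
theorem of the tree is `K`-parametric, hence unconditional under this statement. Implied by the
named fact `evertseGyory_thm_4_2_1_rat` (`approximationBound_rat_of_evertseGyory`).
[cite: Pasten2024, Theorem 2.1 (d = 1)] [cite: EvertseGyory2015, Thm 4.2.1 (p. 68), K = ℚ, α = 1] -/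
def approximationBound_rat : Prop := ∃ K : ℝ, 1 ≤ K ∧ PastenApproximationBound K

/-- **Archimedean half** ("A1.L(∞)"): the archimedean clause of `PastenApproximationBound` with
`∃ K ≥ 1`: for non-torsion `ξ₁,…,ξ_m ∈ ℚ*` and `x = ±∏ξᵢ^{bᵢ} ≠ 1`,
`log|1 − x| > −K^m · log max{e, h(x)} · ∏ h(ξᵢ)`.
[cite: Pasten2024, Theorem 2.1 (i) (d = 1)] [cite: EvertseGyory2015, Thm 4.2.1 (p. 68), v infinite, K = ℚ, α = 1] -/
def archApproximationBound_rat : Prop :=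
  ∃ K : ℝ, 1 ≤ K ∧ ∀ (ι : Type) [Fintype ι], 0 < Fintype.card ι → ∀ ξ : ι → ℚ,
    (∀ i, ξ i ≠ 0 ∧ ξ i ≠ 1 ∧ ξ i ≠ -1) → ∀ ζ : ℚ, (ζ = 1 ∨ ζ = -1) → ∀ b : ι → ℤ,
    ζ * ∏ i, ξ i ^ b i ≠ 1 →
      -(K ^ Fintype.card ι * Real.log (max (Real.exp 1) (logHeight₁ (ζ * ∏ i, ξ i ^ b i))) *
          ∏ i, logHeight₁ (ξ i)) <
        Real.log |1 - ((ζ * ∏ i, ξ i ^ b i : ℚ) : ℝ)|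

/-- **`p`-adic half** ("A1.L(p)"): the `p`-adic clause of `PastenApproximationBound` with `∃ K ≥ 1`:
for non-torsion `ξ₁,…,ξ_m ∈ ℚ*`, `x = ±∏ξᵢ^{bᵢ} ≠ 1` and every prime `p`,
`ord_p(1 − x) · log p < K^m · (p/log p) · log max{e, p·h(x)} · ∏ h(ξᵢ)` (same text, up to `1 ≤ K`,
as the route item `Summit.ABC.ABC.Theses.GiantExponentRegime.PadicUnitBound`).
[cite: Pasten2024, Theorem 2.1 (ii) (d = 1)] [cite: EvertseGyory2015, Thm 4.2.1 (p. 68), v finite, K = ℚ, α = 1] -/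
def padicApproximationBound_rat : Prop :=
  ∃ K : ℝ, 1 ≤ K ∧ ∀ (ι : Type) [Fintype ι], 0 < Fintype.card ι → ∀ ξ : ι → ℚ,
    (∀ i, ξ i ≠ 0 ∧ ξ i ≠ 1 ∧ ξ i ≠ -1) → ∀ ζ : ℚ, (ζ = 1 ∨ ζ = -1) → ∀ b : ι → ℤ,
    ζ * ∏ i, ξ i ^ b i ≠ 1 → ∀ p : ℕ, p.Prime →
      (padicValRat p (1 - ζ * ∏ i, ξ i ^ b i) : ℝ) * Real.log p <
        K ^ Fintype.card ι * (p / Real.log p) *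
          Real.log (max (Real.exp 1) (p * logHeight₁ (ζ * ∏ i, ξ i ^ b i))) *
          ∏ i, logHeight₁ (ξ i)

/-! ### Links (all proved) -/

/-- `PastenApproximationBound K` for some `K ≥ 1` gives the shape statement.
[cite: Pasten2024, Theorem 2.1 (d = 1)] -/
theorem approximationBound_rat_of_pasten {K : ℝ} (hK : 1 ≤ K) (h : PastenApproximationBound K) :
    approximationBound_rat :=
  ⟨K, hK, h⟩

/-- **The shape statement follows from the named fact `evertseGyory_thm_4_2_1_rat`** (through
`pasten2024_thm_2_1`, `K = pastenK = 480·(16e)^8`).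
[cite: Pasten2024, Theorem 2.1 (d = 1)] [cite: EvertseGyory2015, Thm 4.2.1 (p. 68)] -/
theorem approximationBound_rat_of_evertseGyory (h : evertseGyory_thm_4_2_1_rat) :
    approximationBound_rat :=
  ⟨pastenK, one_le_pastenK, pasten2024_thm_2_1 h⟩

/-- The cast identity behind the two orientations of the archimedean clause. [folklore] -/
private theorem cast_one_sub (x : ℚ) : ((1 - x : ℚ) : ℝ) = 1 - (x : ℝ) := by
  push_cast; ring

/-- Projection to the archimedean half. [cite: Pasten2024, Theorem 2.1 (i) (d = 1)] -/
theorem archApproximationBound_rat_of (h : approximationBound_rat) : archApproximationBound_rat := by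
  obtain ⟨K, hK, hP⟩ := h
  refine ⟨K, hK, fun ι _ hι ξ hξ ζ hζ b hx => ?_⟩
  have h1 := (hP ι hι ξ hξ ζ hζ b hx).1
  rw [cast_one_sub] at h1
  linarith

/-- Projection to the `p`-adic half. [cite: Pasten2024, Theorem 2.1 (ii) (d = 1)] -/
theorem padicApproximationBound_rat_of (h : approximationBound_rat) : padicApproximationBound_rat := by
  obtain ⟨K, hK, hP⟩ := h
  exact ⟨K, hK, fun ι _ hι ξ hξ ζ hζ b hx p hp => (hP ι hι ξ hξ ζ hζ b hx).2 p hp⟩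

/-- Monotonicity of the bound's constant: `K^m ≤ K'^m` for `1 ≤ K ≤ K'`. [folklore] -/
private theorem pow_mono_of_one_le {K K' : ℝ} (hK : 1 ≤ K) (hKK' : K ≤ K') (m : ℕ) :
    K ^ m ≤ K' ^ m :=
  pow_le_pow_left₀ (zero_le_one.trans hK) hKK' m

/-- **The two halves give the shape statement** (`K := max K∞ K_p`; the clauses are monotone in
`K ≥ 1` because `log max{e, ·} ≥ 1 > 0`, `p / log p > 0` and `∏ h(ξᵢ) ≥ 0`).
[cite: Pasten2024, Theorem 2.1 (d = 1)] -/
theorem approximationBound_rat_of_halves (h₁ : archApproximationBound_rat)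
    (h₂ : padicApproximationBound_rat) : approximationBound_rat := by
  obtain ⟨K₁, hK₁, hA⟩ := h₁
  obtain ⟨K₂, hK₂, hN⟩ := h₂
  refine ⟨max K₁ K₂, le_max_of_le_left hK₁, fun ι _ hι ξ hξ ζ hζ b hx => ⟨?_, fun p hp => ?_⟩⟩
  · have h := hA ι hι ξ hξ ζ hζ b hx
    have hΘ : 0 ≤ ∏ i, logHeight₁ (ξ i) := Finset.prod_nonneg fun i _ => zero_le_logHeight₁ _
    have hlog : 0 ≤ Real.log (max (Real.exp 1) (logHeight₁ (ζ * ∏ i, ξ i ^ b i))) :=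
      Real.log_nonneg ((Real.one_lt_exp_iff.mpr one_pos).le.trans (le_max_left _ _))
    have hpow : K₁ ^ Fintype.card ι ≤ (max K₁ K₂) ^ Fintype.card ι :=
      pow_mono_of_one_le hK₁ (le_max_left _ _) _
    have hmono : K₁ ^ Fintype.card ι *
          Real.log (max (Real.exp 1) (logHeight₁ (ζ * ∏ i, ξ i ^ b i))) * ∏ i, logHeight₁ (ξ i) ≤
        (max K₁ K₂) ^ Fintype.card ι *
          Real.log (max (Real.exp 1) (logHeight₁ (ζ * ∏ i, ξ i ^ b i))) * ∏ i, logHeight₁ (ξ i) :=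
      mul_le_mul_of_nonneg_right (mul_le_mul_of_nonneg_right hpow hlog) hΘ
    rw [cast_one_sub]
    linarith
  · have h := hN ι hι ξ hξ ζ hζ b hx p hp
    have hΘ : 0 ≤ ∏ i, logHeight₁ (ξ i) := Finset.prod_nonneg fun i _ => zero_le_logHeight₁ _
    have hlog : 0 ≤ Real.log (max (Real.exp 1) (p * logHeight₁ (ζ * ∏ i, ξ i ^ b i))) :=
      Real.log_nonneg ((Real.one_lt_exp_iff.mpr one_pos).le.trans (le_max_left _ _))
    have hp0 : 0 ≤ (p : ℝ) / Real.log p :=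
      div_nonneg (Nat.cast_nonneg p) (Real.log_nonneg (by exact_mod_cast hp.one_lt.le))
    have hpow : K₂ ^ Fintype.card ι ≤ (max K₁ K₂) ^ Fintype.card ι :=
      pow_mono_of_one_le hK₂ (le_max_right _ _) _
    have hmono : K₂ ^ Fintype.card ι * (p / Real.log p) *
          Real.log (max (Real.exp 1) (p * logHeight₁ (ζ * ∏ i, ξ i ^ b i))) *
          ∏ i, logHeight₁ (ξ i) ≤
        (max K₁ K₂) ^ Fintype.card ι * (p / Real.log p) *
          Real.log (max (Real.exp 1) (p * logHeight₁ (ζ * ∏ i, ξ i ^ b i))) *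
          ∏ i, logHeight₁ (ξ i) :=
      mul_le_mul_of_nonneg_right
        (mul_le_mul_of_nonneg_right (mul_le_mul_of_nonneg_right hpow hp0) hlog) hΘ
    exact h.trans_le hmono

/-- `approximationBound_rat ↔ archApproximationBound_rat ∧ padicApproximationBound_rat`.
[cite: Pasten2024, Theorem 2.1 (d = 1)] -/
theorem approximationBound_rat_iff_halves :
    approximationBound_rat ↔ archApproximationBound_rat ∧ padicApproximationBound_rat :=
  ⟨fun h => ⟨archApproximationBound_rat_of h, padicApproximationBound_rat_of h⟩,
    fun h => approximationBound_rat_of_halves h.1 h.2⟩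

/-- The two halves follow from the named fact `evertseGyory_thm_4_2_1_rat`.
[cite: EvertseGyory2015, Thm 4.2.1 (p. 68)] -/
theorem archApproximationBound_rat_of_evertseGyory (h : evertseGyory_thm_4_2_1_rat) :
    archApproximationBound_rat :=
  archApproximationBound_rat_of (approximationBound_rat_of_evertseGyory h)

/-- The `p`-adic half follows from the named fact `evertseGyory_thm_4_2_1_rat`.
[cite: EvertseGyory2015, Thm 4.2.1 (p. 68)] -/
theorem padicApproximationBound_rat_of_evertseGyory (h : evertseGyory_thm_4_2_1_rat) :
    padicApproximationBound_rat :=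
  padicApproximationBound_rat_of (approximationBound_rat_of_evertseGyory h)

end Literature.NumberTheory.DiophantineGeometry.Dioph

end
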